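import Mathlib
import HarnessLib
import Summits.BirchSwinnertonDyer.BirchSwinnertonDyer.Theses.ManinLocalTwoThree
import Summits.BirchSwinnertonDyer.BirchSwinnertonDyer.Theorems.ManinLocalTwoThreeHalvingCoverUDC
import Literature.NumberTheory.Automorphic.UnboundedDenominators

/-!
# Lines/halving_udc.lean — v1 (lead p1 gen 18, 2026-08-29T23:3xZ): THE HALVING LINE — Unbounded Denominators on the 2-DIVISION COVER of φ₀.
#
# IDEA (LEAD-MEMO v38; `Theorems/ManinLocalTwoThreeHalvingCoverUDC.lean`, p750507): for a lattice-optimal datum D of a globally minimal W at 4 ∣ N with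
# 2 ∣ c, put c' = c/2 ∈ ℤ and Q(τ) = c'·E_f(τ) mod Λ_W («half of φ(τ)»).  Functions of Q are modular for EXACTLY the halving cover group
# Γ^{(2)} = {γ ∈ Γ₀(N) : c{∞,γ∞}_f ∈ 2Λ_W} = per⁻¹(2Λ₀(f)) — finite index, normal, type II — which is NONCONGRUENCE unless Γ₁(N) ≤ Γ^{(2)}, i.e.
# unless Λ₁(f) = 2Λ₀(f) (INDEX 4) [Kurth–Long, tree theorem; `Halving.halvingCover_noncongruence`].  The parameter t(Q(τ)) has q-expansion
# exp_W(c'·Σaₙqⁿ/n) ∈ ℤ⟦q⟧ (Honda at the INTEGER c', tree `exists_int_coeff_formalExp_subst_lSeriesLog`), so the pole-cleared F = t(Q)·B_d·f^a·Δ^m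
# is a weight-k modular form for Γ^{(2)} with algebraic-integer coefficients (the HALVING WITNESS); CDT ⟹ congruence ⟹ INDEX 4
# [`Halving.indexFour_of_halvingWitness_of_UDW`]; E-an-152b (index ≠ 4) finishes.  COMPOSITION `Halving.maninOddAtFour_of_CDT_halvingWitnessLaw_indexNeFour`.
# STUBS (3): `stub_CDT_algInt` (PRINTED, cite-only) · `stub_halvingWitnessLaw` (OPEN — ANALYTIC BOOKKEEPING with a complete paper proof: the port of p2's
# landed AN2₂ chain (INT₂)/(DICT₂)/(RATB)/(HOLB₂)/(QEXNB)/(INVB₂)/(QXP) from the σ-square root V_T(c·E_f) to the parameter t(c'·E_f); pole set ⊂ φ⁻¹(O))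
# · `stub_shimuraIndexNeFourAtFour` (E-an-152b, c-free LAW; THEOREM at every cyclic-cuspidal-inertia level, 2-power levels, 4pq, 16pq-twists; NECESSARY
# for C2 by E-an-68).  NO Kato fact, NO F★/F♮/CES/F-es-21♭K, NO rational-2-torsion / blindness / gain-locus hypothesis: the kernel-generator vacuity of
# kato_shift_two v26/v27 disappears because the full [2]-cover is defined over ℚ and sees all of E[2] at once (p2's chain and LEAD's FullTwoTorsion are
# its three intermediate quadratic covers).  So, modulo CDT and the witness law, **C2 ⟺ E-an-152b** (⟸ here; ⟹ is E-an-68 + CES).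
# HONEST FRAMING: CONDITIONAL reduction; the witness law is OPEN (L-sized port), E-an-152b is OPEN at rank-≥2 inertia levels, CDT is printed only;
# BSD is not proved; Manin's conjecture at 2 is not proved.
-/

set_option autoImplicit false
set_option linter.dupNamespace false

noncomputable section

open scoped MatrixGroups ModularForm Manifold
open CongruenceSubgroup WeierstrassCurve Literature.NumberTheory.EllipticCurves Literature.NumberTheory.EllipticCurves.ModularForms
  Summit.BirchSwinnertonDyer.Rank1Residual.ManinAdditive.ShimuraKernel

namespace Summit.BirchSwinnertonDyer.BirchSwinnertonDyer.Cruxes.ManinOddAtFour.HalvingUDC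

/-- STUB (PRINTED) CDT-algInt — Calegari–Dimitrov–Tang 2025 Thm. 1.0.1 with Remarks 58–59 (Unbounded Denominators, algebraic-integer coefficients), the
vendored statement-only fact; CITE-ONLY. -/
theorem stub_CDT_algInt : Literature.NumberTheory.Automorphic.CalegariDimitrovTang2025_unboundedDenominators_algInt := by
  sorry

/-- STUB (OPEN, analytic bookkeeping) — THE HALVING WITNESS LAW: for every lattice-optimal datum at `4 ∣ N` of a globally minimal curve with `2 ∣ c` there is
a holomorphic `F : ℍ → ℂ` of some weight `k` whose `Γ₀(N)`-stabiliser is EXACTLY the halving cover group `{γ : c{∞,γ∞}_f ∈ 2Λ_W}`, with exponential growth at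
every cusp and an algebraic-integer `q`-expansion.  Paper proof: `F = t(Q)·B_d·f^a·Δ^m`, `Q = (c/2)·E_f`, `t = −x/y`; integrality by Honda at `c/2`
(tree `exists_int_coeff_formalExp_subst_lSeriesLog`); `B_d` the integral `Γ₀(N)`-form killing the poles of `t(Q)` inside `ℍ` (they lie over `φ⁻¹(O)`;
j-polynomial construction of (RATB)); holomorphy/growth as (HOLB₂); `q`-expansion identification as (DICT₂)/(QEXNB)/(QXP); stabiliser exactness: `F|γ = F`
forces `t(Q + T_γ) ≡ t(Q)` hence `T_γ = O` (`t(O) = 0`, `t` has poles at `E[2] ∖ O`).  Why it might fail: only in bookkeeping — every step is the landed AN2₂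
chain with `V_T(c·E_f)` replaced by `t((c/2)·E_f)`. -/
theorem stub_halvingWitnessLaw :
    ∀ (W : WeierstrassCurve ℚ) [W.IsElliptic] [W.IsGloballyMinimal] {N : ℕ} [NeZero N] (D : ModularParametrizationData W N),
      2 ^ 2 ∣ N → (∀ z ∈ D.L.lattice, ∃ w ∈ periodLattice D.f, z = D.c * w) → (2 : ℤ) ∣ D.c →
      ∃ (k : ℤ) (F : UpperHalfPlane → ℂ), MDifferentiable 𝓘(ℂ) 𝓘(ℂ) F ∧
        (∀ γ : Gamma0 N, (∃ ν ∈ D.L.lattice, (D.c : ℂ) * cuspSymbol D.f γ = 2 * ν) → F ∣[k] (γ : SL(2, ℤ)) = F) ∧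
        (∀ γ : Gamma0 N, F ∣[k] (γ : SL(2, ℤ)) = F → ∃ ν ∈ D.L.lattice, (D.c : ℂ) * cuspSymbol D.f γ = 2 * ν) ∧
        (∀ g : SL(2, ℤ), ∃ C A m : ℝ, ∀ τ : UpperHalfPlane, A ≤ τ.im → ‖(F ∣[k] g) τ‖ ≤ C * Real.exp (m * τ.im)) ∧
        (∃ b : ℕ → ℂ, (∀ n, IsIntegral ℤ (b n)) ∧ ∀ τ : UpperHalfPlane,
          HasSum (fun n : ℕ ↦ b n * Complex.exp (2 * Real.pi * Complex.I * (τ : ℂ) * n)) (F τ)) := by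
  sorry

/-- STUB (LAW) E-an-152b `ShimuraKernel.ShimuraIndexNeFourAtFour` — no lattice-optimal `X₀(N)`-datum at `4 ∣ N` has `Λ₁(f) = 2Λ₀(f)`.  c-free; NECESSARY for
C2 (E-an-68: index 4 ⟹ `c₀ = ±2c₁`); a THEOREM at every level whose cuspidal-inertia group `(ℤ/uv)ˣ/{±1}` is cyclic (`…ShimuraQuotientLevelInstances`,
`…FourP`, `…FourPQ`, `…QuarterShiftGamma1Orbit`); OPEN at rank-≥2 levels (16pq, 48p, …), where its failure = the «index-4 world» (full rational 2-torsion,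
`E₁ = E₀`, `φ₀∘π = ±[2]∘φ₁`). -/
theorem stub_shimuraIndexNeFourAtFour : ShimuraIndexNeFourAtFour := by
  sorry

/-- COMPOSITION (no sorry): `Halving.maninOddAtFour_of_CDT_halvingWitnessLaw_indexNeFour` (LEAD p1 g18, p750507). -/
theorem ManinOddAtFour_of :
    Summit.BirchSwinnertonDyer.BirchSwinnertonDyer.Theses.ManinLocalTwoThree.ManinOddAtFour :=
  Summit.BirchSwinnertonDyer.BirchSwinnertonDyer.Theorems.ManinLocalTwoThree.Halving.maninOddAtFour_of_CDT_halvingWitnessLaw_indexNeFour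
    stub_CDT_algInt stub_halvingWitnessLaw stub_shimuraIndexNeFourAtFour

end Summit.BirchSwinnertonDyer.BirchSwinnertonDyer.Cruxes.ManinOddAtFour.HalvingUDC

end
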